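import Literature.Topology.FourManifolds.PropertyRStrict
import Literature.Topology.FourManifolds.RLinkSphere
import Literature.Topology.FourManifolds.KirbyCalculus
import HarnessLib

/-!
# Helper `helper_stdSphereSlides_zero` of line `sphere_split` for crux
`VerlindeRLinks.VrlSliceRigidity` (item stmt-SmoothPoincare4-16179, route route-SmoothPoincare4-VerlindeRLinks)

**The slice `n = 0` of the heart `stub_stdSphereSlides` ("generalised Property R on the standard
`S⁴`") holds outright.** A framed link in `S³` with no components is already a `0`-framed split
unlink (`FramedLink.isZeroFramedUnlink_of_isEmpty`: both clauses of `FramedLink.IsZeroFramedUnlink`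
quantify over the empty index type `Fin 0`), and it is strictly handle-slide equivalent to itself
(`IsStrictHandleSlideEquivalent = Relation.EqvGen StrictHandleSlideMove` is reflexive). So
`U := L` witnesses the conclusion; no surgery, sphere or slide hypothesis is needed, exactly as for
the permissive-calculus twin `Literature.Topology.FourManifolds.generalizedPropertyRConjecture_zero`
(`KirbyCalculus.lean`).

Why it is recorded: the heart of the line (`stub_stdSphereSlides`, GPRC restricted to R-links whose
closed manifold `Σ_L` is the standard `S⁴`) is an open problem for `n ≥ 2` (it implies unstable
Andrews–Curtis triviality of the Akbulut–Kirby presentations, Gompf–Scharlemann–Thompson 2010 §7,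
§9); this bookkeeping helper confines its content visibly to `n ≥ 1` (and the `n = 1` slice is
Gabai's Property R, a separate helper). Gompf–Scharlemann–Thompson (2010), §2 state Conjecture 1
for `n ≥ 1` precisely because the case `n = 0` is empty of content.

Sources: R. E. Gompf, M. Scharlemann, A. Thompson, *Fibered knots and potential counterexamples to
the Property 2R and Slice-Ribbon Conjectures*, Geom. Topol. 14 (2010), §2 Conjecture 1, §9;
R. Kirby (ed.), *Problems in low-dimensional topology* (1997), Problem 1.82.

The file declares one theorem (pure logic over the tree's definitions) and no notation.
-/

noncomputable section

set_option linter.dupNamespace false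

namespace Summit.SmoothPoincare4.SmoothPoincare4.Theorems.VrlSliceRigidity.SphereSplit

open scoped Manifold ContDiff Topology
open Set Function Literature.Topology.FourManifolds

-- (The line's local notations `𝔼 n` / `𝕊 n` are not needed: the `n = 0` signature mentions no
-- model space or sphere.)

/-- **The slice `n = 0` of GPRC on the standard sphere holds** (trivially): a framed link with no
components is its own `0`-framed split unlink (`FramedLink.isZeroFramedUnlink_of_isEmpty`) and is
strictly handle-slide equivalent to itself (`Relation.EqvGen.refl`). The strict-calculus analogue
of `Literature.Topology.FourManifolds.generalizedPropertyRConjecture_zero`; Gompf–Scharlemann–Thompson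
(2010), §2 pose Conjecture 1 for `n ≥ 1` because this case is empty of content. [folklore] -/
theorem helper_stdSphereSlides_zero : ∀ [Knot.TubularNbhd.SmoothnessFacts] (L : FramedLink (Fin 0)), ∃ U : FramedLink (Fin 0), U.IsZeroFramedUnlink ∧ IsStrictHandleSlideEquivalent ⟨0, L⟩ ⟨0, U⟩ :=
  @fun _ L => ⟨L, L.isZeroFramedUnlink_of_isEmpty, Relation.EqvGen.refl _⟩

end Summit.SmoothPoincare4.SmoothPoincare4.Theorems.VrlSliceRigidity.SphereSplit

end
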